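import Summits.CriticalPhenomena.PercolationContinuityZ3.Theorems.PercNearOneGluingNoHeavyQuantTwoMidCellCoupling
import Summits.CriticalPhenomena.PercolationContinuityZ3.Theorems.PercNearOneGluingNoHeavyQuantTwoMidCellBrackets
import HarnessLib

/-!
# QUANT lane R8, T-DEC: the TWO-MID CELL of `LightSliceLowCrossBelow` — the piecewise-linear bracket lemmas and THE CELL INEQUALITY
# `TwoMidCell.main` (census-2 g60)

builds on p205010 (kernel theorem, internal audit signed; external expert review pending)

Support file (`--supports stmt-CriticalPhenomena-4575`), QUANT lane seat prim-quant-census-2 (gen 60), rung R8 of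
`run/shared/lean/prim/quant/LADDER.md`.  Memo `run/shared/lean/prim/quant/prim-quant-census-2-g60/TWO-MID-G60.md`.  Theorems only,
standard axioms, no sorries, no definitions.

THE CELL (memo §1–§2).  The light slice of side 1 in the class `LightSliceLowCrossBelow` (both Type II, `h′ < h`, and Type I, `h′ = h`) is an
eight-term law with four conv-lows `P1 = p+l` (mass `(1−γ)m_E`), `P2 = p+l′` (`(1−γ)m_C`), `M1 = m+l` (`γm_E`), `M2 = m+l′` (`γm_C`), the head
mid `H = p+h′` (mass `(1−γ)m_C c₂`), the second mid `G = p+h` (mass `(1−γ)m_E c₁`; in Type I the two mids coincide) and giants of mass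
`γ(m_E c₁ + m_C c₂) = γu(m_E + m_C)` (balance).  By the price criteria `decAtT_of_twoMid_terms` / `decAtT_of_oneMid_terms` it is DEC as soon
as, for all prices `β_H, β_G ≥ 0`,
`(1−γ)m_E·α_{P1} + (1−γ)m_C·α_{P2} + γm_E·α_{M1} + γm_C·α_{M2} ≤ β_H(1−γ)m_C c₂ + β_G(1−γ)m_E c₁ + γ(m_E + m_C)`
with `α_{P1} = min(1, U_{P1G}β_G)` (or `1` if incompatible), `α_{M1} = min(1, U_{M1G}β_G)`, `α_{P2} = min(1, U_{P2H}β_H)` (or `1`),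
`α_{M2} = min(1, U_{M2H}β_H)` — each low priced only against its own row's mid, which is weaker than the criterion asks.
Bracket lemmas (`b2_lower`, `b1_lower`, `b1_lower_of_cap`) are in `…QuantTwoMidCellBrackets`.
* **`TwoMidCell.main`** — the displayed inequality, for the closed-form usages of the cell (hypotheses = the rate identities supplied by the
  class theorems `…LightSliceLowCrossBelowCrossed` / `…TypeI`), with `ℓ = 2ra·max(1−2γ,0)` and the rate lemmas of `…TwoMidCellRates` /
  `…TwoMidCellCoupling`.
EXACT EVIDENCE before the proof (memo §5): the cell LP has 0 failures on 4 500 boundary-pushed samples of the relaxed 6-variable region and on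
the embedded instances (kit j163808: 3 885 Type II + 86 791 Type I at M ≤ 8); the bracket split `κ·D₁ ≤ m₂` holds with ratio ≤ 0.015.

[this work].  The gluing rows served [cite: KozmaNitzan2024, Conjecture 3 (p. 15)]; product measure [cite: Grimmett1999, §1.3 p. 10].
-/

noncomputable section

namespace Summit.CriticalPhenomena.PercolationContinuityZ3.Theorems

namespace Quant

namespace LawDec

namespace TwoMidCell

/-- light usage `U_ℓ(ρ) = (x² + (1−x)ρ)/((1−x)(1+x−ρ))` -/
local notation3 "UL[" x ", " ρ "]" => ((x : ℝ) ^ 2 + (1 - x) * ρ) / ((1 - x) * (1 + x - ρ))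

/-! ### the cell inequality -/

set_option maxHeartbeats 4000000 in
/-- **THE TWO-MID CELL INEQUALITY.**  See the module docstring. [this work] -/
theorem main (x r c a ρe ε mE mC c₁ c₂ UP1 UM1 UP2 UM2 βH βG : ℝ) (cP1 cP2 : Prop) [Decidable cP1] [Decidable cP2]
    (hx0 : 0 < x) (hx1 : x < 1) (hr0 : 0 ≤ r) (hrx : r < x) (hcx : c < x) (ha0 : 0 < a) (ha1 : a < 1)
    (hlc : (2 - r) * a < c) (hρe : x < ρe) (hρe1 : ρe < 1) (hd : 2 - c ≤ ε * (2 - ρe))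
    (hmC : 0 < mC) (hmE : 0 ≤ mE) (hbal : mE * (c₁ - x / (1 - x)) = mC * (x / (1 - x) - c₂))
    (hc₁ : c₁ = ρe / (1 - ρe)) (hc₂ : c₂ = UL[x, c])
    (hcP2 : cP2 ↔ c + r * a < 1)
    (hUP2l : c + r * a ≤ x → UP2 = UL[x, c + r * a])
    (hUP2h : x ≤ c + r * a → c + r * a < 1 → UP2 = (c + r * a) / (1 - (c + r * a)))
    (hUM2 : UM2 = UL[x, (c + r * a - 2 * a) / (1 - a)])
    (hcP1 : cP1 ↔ ρe + r * a / ε < 1)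
    (hUP1 : ρe + r * a / ε < 1 → UP1 = (ρe + r * a / ε) / (1 - (ρe + r * a / ε)))
    (hUM1l : ρe - a * (2 - ρe - r) / (ε - a) ≤ x → UM1 = UL[x, ρe - a * (2 - ρe - r) / (ε - a)])
    (hUM1h : x ≤ ρe - a * (2 - ρe - r) / (ε - a) →
      UM1 = (ρe - a * (2 - ρe - r) / (ε - a)) / (1 - (ρe - a * (2 - ρe - r) / (ε - a))))
    (hβH : 0 ≤ βH) (hβG : 0 ≤ βG) :
    (1 - (x ^ 2 + (1 - x) * r)) * mE * (if cP1 then min 1 (UP1 * βG) else 1)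
      + (1 - (x ^ 2 + (1 - x) * r)) * mC * (if cP2 then min 1 (UP2 * βH) else 1)
      + (x ^ 2 + (1 - x) * r) * mE * min 1 (UM1 * βG)
      + (x ^ 2 + (1 - x) * r) * mC * min 1 (UM2 * βH)
    ≤ βH * ((1 - (x ^ 2 + (1 - x) * r)) * mC * c₂) + βG * ((1 - (x ^ 2 + (1 - x) * r)) * mE * c₁)
      + ((1 - x) / x) * ((x ^ 2 + (1 - x) * r) * (mE * c₁ + mC * c₂)) := by
  -- ### names
  obtain ⟨γ, hγ⟩ : ∃ γ : ℝ, γ = x ^ 2 + (1 - x) * r := ⟨_, rfl⟩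
  obtain ⟨ρP, hρP⟩ : ∃ ρP : ℝ, ρP = c + r * a := ⟨_, rfl⟩
  obtain ⟨ρM, hρM⟩ : ∃ ρM : ℝ, ρM = (c + r * a - 2 * a) / (1 - a) := ⟨_, rfl⟩
  obtain ⟨ρS, hρS⟩ : ∃ ρS : ℝ, ρS = ρe + r * a / ε := ⟨_, rfl⟩
  obtain ⟨ρN, hρN⟩ : ∃ ρN : ℝ, ρN = ρe - a * (2 - ρe - r) / (ε - a) := ⟨_, rfl⟩
  obtain ⟨δ, hδ⟩ : ∃ δ : ℝ, δ = r * a / ε := ⟨_, rfl⟩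
  obtain ⟨η, hη⟩ : ∃ η : ℝ, η = a * (2 - ρe - r) / (ε - a) := ⟨_, rfl⟩
  rw [← hγ]
  rw [← hρP] at hcP2 hUP2l hUP2h
  rw [← hρM] at hUM2
  rw [← hρS] at hcP1 hUP1
  rw [← hρN] at hUM1l hUM1h
  -- ### elementary facts
  have h1x : 0 < 1 - x := by linarith
  have hu0 : 0 < x / (1 - x) := div_pos hx0 h1x
  have hγ0 : 0 ≤ γ := by rw [hγ]; nlinarith
  have hγx : γ < x := by rw [hγ]; nlinarith [mul_pos h1x (sub_pos.2 hrx)]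
  have hγ1 : γ ≤ 1 := by linarith
  have h1a : 0 < 1 - a := by linarith
  have hra0 : 0 ≤ r * a := mul_nonneg hr0 ha0.le
  have hc0 : 0 < c := by nlinarith
  have hρM0 : 0 < ρM := by rw [hρM]; apply div_pos _ h1a; nlinarith
  have hρMc : ρM ≤ c := by rw [hρM, div_le_iff₀ h1a]; nlinarith
  have hρMP : ρM ≤ ρP := by rw [hρP]; linarith
  have hρMx : ρM < x := by linarith
  have hε1 : 1 < ε := by
    by_contra hle; push Not at hle
    have : ε * (2 - ρe) ≤ 1 * (2 - ρe) := mul_le_mul_of_nonneg_right hle (by linarith)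
    linarith
  have hε0 : 0 < ε := by linarith
  have hεa' : 0 < ε - a := by linarith
  have hδ0 : 0 ≤ δ := by rw [hδ]; exact div_nonneg hra0 hε0.le
  have hη0 : 0 ≤ η := by rw [hη]; exact div_nonneg (mul_nonneg ha0.le (by linarith)) hεa'.le
  have eS : ρS = ρe + δ := by rw [hρS, hδ]
  have eN : ρN = ρe - η := by rw [hρN, hη]
  have hρSe : ρe ≤ ρS := by rw [eS]; linarith
  have hρNe : ρN ≤ ρe := by rw [eN]; linarith
  have hρN0 : 0 < ρN := by
    rw [hρN, sub_pos, div_lt_iff₀ hεa']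
    have h1 : a * (2 - r) < c := by linarith
    have h2 : c * (2 - ρe) ≤ ρe * (2 - c) := by nlinarith
    have h3 : ρe * (2 - c) ≤ ρe * (ε * (2 - ρe)) := mul_le_mul_of_nonneg_left hd (by linarith)
    have h4 : c ≤ ρe * ε :=
      le_of_mul_le_mul_right (by nlinarith : c * (2 - ρe) ≤ ρe * ε * (2 - ρe)) (by linarith : (0:ℝ) < 2 - ρe)
    linarith
  have hρSx : x ≤ ρS := by linarith
  have hc₂0 : 0 < c₂ := by rw [hc₂]; exact UL_pos x c hx0 hx1 hc0.le (by linarith)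
  have hc₁u : x / (1 - x) < c₁ := by rw [hc₁, div_lt_div_iff₀ h1x (by linarith)]; nlinarith
  have hUM20 : 0 < UM2 := by rw [hUM2]; exact UL_pos x ρM hx0 hx1 hρM0.le (by linarith)
  have hUM2c : UM2 ≤ c₂ := by rw [hUM2, hc₂]; exact UL_mono x c ρM hx1 (by linarith) (by linarith) hρMc
  have hUM2u : UM2 ≤ x / (1 - x) := by rw [hUM2]; exact CrossGiantCell.Ul_le_u x ρM hx0 hx1 hρMx.le
  -- ### the coupling constant
  obtain ⟨ℓ, hℓ⟩ : ∃ ℓ : ℝ, ℓ = 2 * r * a * max (1 - 2 * γ) 0 := ⟨_, rfl⟩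
  have hℓ0 : 0 ≤ ℓ := by rw [hℓ]; exact mul_nonneg (by nlinarith) (le_max_right _ _)
  have hℓ_lo : γ < 1 / 2 → ℓ = 2 * r * a * (1 - 2 * γ) := by intro h; rw [hℓ, max_eq_left (by linarith)]
  have hℓ_hi : 1 / 2 ≤ γ → ℓ = 0 := by intro h; rw [hℓ, max_eq_right (by linarith), mul_zero]
  -- ### bracket 2
  have hb2 := b2_lower γ c₂ UP2 UM2 ℓ βH cP2 hγ1 hβH hUM20 hUM2c ?hUP2 ?hℓ0' ?hℓ0'' ?hℓ1 ?hℓ2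
  case hUP2 =>
    intro hc
    have hP1 : ρP < 1 := hcP2.1 hc
    rcases le_or_gt ρP x with hPx | hPx
    · rw [hUP2l hPx, hUM2]
      exact ⟨UL_pos x ρP hx0 hx1 (by linarith) (by linarith), UL_mono x ρP ρM hx1 (by linarith) (by linarith) hρMP⟩
    · rw [hUP2h hPx.le hP1]
      exact ⟨div_pos (by linarith) (by linarith), le_trans hUM2u (UH_mono ρP x hP1 hPx.le)⟩
  case hℓ0' =>
    intro _
    rcases lt_or_ge γ (1 / 2) with h | h
    · rw [hℓ_lo h]; exact R_D x r c a γ hγ hx0 hx1 hr0 hrx hcx ha0 hlc h.le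
    · rw [hℓ_hi h]; exact hγ0
  case hℓ0'' =>
    intro hnc
    have hP1 : 1 ≤ ρP := by
      by_contra hlt; push Not at hlt; exact hnc (hcP2.2 hlt)
    have hhalf := CrossGiantCell.half_le_gamma_of_incompatible x r c a hx1 hr0 hrx hcx hlc (by rw [hρP] at hP1; exact hP1)
    rw [hℓ_hi (by rw [hγ]; exact hhalf)]; linarith [show 1 / 2 ≤ γ by rw [hγ]; exact hhalf]
  case hℓ1 =>
    intro hc
    have hP1 : ρP < 1 := hcP2.1 hc
    rcases lt_or_ge γ (1 / 2) with h | h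
    · rw [hℓ_lo h]
      rcases le_or_gt ρP x with hPx | hPx
      · rw [hUP2l hPx, hUM2, hc₂]
        exact R_Bl x r c a γ ρP ρM hγ hρP hρM hx0 hx1 hr0 hrx hcx ha0 ha1 hlc hPx h.le
      · rw [hUP2h hPx.le hP1, hUM2, hc₂]
        exact R_Bh x r c a γ ρP ρM hγ hρP hρM hx0 hx1 hr0 hrx hcx ha0 ha1 hlc hPx.le hP1 h.le
    · rw [hℓ_hi h, zero_mul]
      rcases le_or_gt ρP x with hPx | hPx
      · rw [hUP2l hPx, hUM2, hc₂]
        exact R_Al x r c a γ ρP ρM hγ hρP hρM hx0 hx1 hr0 hrx hcx ha0 ha1 hlc hPx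
      · rw [hUP2h hPx.le hP1, hUM2, hc₂]
        exact R_Ah x r c a γ ρP ρM hγ hρP hρM hx0 hx1 hr0 hrx hcx ha0 ha1 hlc hPx.le hP1
  case hℓ2 =>
    rcases lt_or_ge γ (1 / 2) with h | h
    · rw [hℓ_lo h, hUM2, hc₂]
      exact R_C x r c a γ ρM hγ hρM hx0 hx1 hr0 hrx hcx ha0 ha1 hlc h.le
    · rw [hℓ_hi h, zero_mul]
      exact mul_nonneg (by linarith) (by linarith)
  -- ### bracket 1
  -- the mass ratio `κ = mE/mC = (x−c)(1−ρe)/((1+x−c)(ρe−x))`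
  have hκ : mE = mC * ((x - c) * (1 - ρe) / ((1 + x - c) * (ρe - x))) := by
    have h1 : (1 : ℝ) - x ≠ 0 := h1x.ne'
    have h2 : (1 : ℝ) + x - c ≠ 0 := by linarith
    have h3 : ρe - x ≠ 0 := by linarith
    have h4 : (1 : ℝ) - ρe ≠ 0 := by linarith
    have e_uc : x / (1 - x) - c₂ = (x - c) / ((1 - x) * (1 + x - c)) := by
      rw [hc₂]; field_simp; ring
    have e_cu : c₁ - x / (1 - x) = (ρe - x) / ((1 - ρe) * (1 - x)) := by
      rw [hc₁]; field_simp; ring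
    rw [e_uc, e_cu] at hbal
    have hA : (ρe - x) / ((1 - ρe) * (1 - x)) ≠ 0 := div_ne_zero h3 (mul_ne_zero h4 h1)
    have e2 : mE = mC * ((x - c) / ((1 - x) * (1 + x - c))) / ((ρe - x) / ((1 - ρe) * (1 - x))) := by
      rw [eq_div_iff hA]; exact hbal
    rw [e2]
    field_simp
  have hUM1_facts : 0 < UM1 ∧ UM1 ≤ c₁ ∧ (cP1 → UM1 ≤ UP1) := by
    rcases le_or_gt ρN x with hNx | hNx
    · rw [hUM1l hNx]
      refine ⟨UL_pos x ρN hx0 hx1 hρN0.le (by linarith), le_trans (CrossGiantCell.Ul_le_u x ρN hx0 hx1 hNx) hc₁u.le, ?_⟩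
      intro hc
      have hS1 := hcP1.1 hc
      rw [hUP1 hS1]
      exact le_trans (CrossGiantCell.Ul_le_u x ρN hx0 hx1 hNx) (UH_mono ρS x hS1 hρSx)
    · rw [hUM1h hNx.le]
      refine ⟨div_pos hρN0 (by linarith), by rw [hc₁]; exact UH_mono ρe ρN hρe1 hρNe, ?_⟩
      intro hc
      have hS1 := hcP1.1 hc
      rw [hUP1 hS1]; exact UH_mono ρS ρN hS1 (le_trans hρNe hρSe)
  obtain ⟨hUM10, hUM1c, hUM1P⟩ := hUM1_facts
  -- common facts for bracket 1
  have hcapE : ¬ cP1 → mE * (1 - 2 * γ) ≤ mC * ℓ := by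
    intro hnc
    rcases lt_or_ge γ (1 / 2) with h | h
    · rw [hℓ_lo h]
      have hS1 : 1 ≤ ρS := by
        by_contra hlt; push Not at hlt; exact hnc (hcP1.2 hlt)
      have hinc : (1 - ρe) * ε ≤ r * a := by
        have : 1 - ρe ≤ r * a / ε := by rw [hρS] at hS1; linarith
        rwa [le_div_iff₀ hε0] at this
      have key := R_E x r c a ρe ε γ hγ hx0 hx1 hr0 hrx hcx ha0 ha1 hlc hρe hρe1 hd h.le hinc
      have hκle : (x - c) * (1 - ρe) / ((1 + x - c) * (ρe - x)) ≤ 2 * r * a := by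
        rw [div_le_iff₀ (mul_pos (by linarith) (by linarith))]; linarith
      rw [hκ]
      have := mul_le_mul_of_nonneg_left hκle (mul_nonneg hmC.le (by linarith : (0:ℝ) ≤ 1 - 2 * γ))
      calc mC * ((x - c) * (1 - ρe) / ((1 + x - c) * (ρe - x))) * (1 - 2 * γ)
          = mC * (1 - 2 * γ) * ((x - c) * (1 - ρe) / ((1 + x - c) * (ρe - x))) := by ring
        _ ≤ mC * (1 - 2 * γ) * (2 * r * a) := this
        _ = mC * (2 * r * a * (1 - 2 * γ)) := by ring
    · have : mE * (1 - 2 * γ) ≤ 0 := mul_nonpos_of_nonneg_of_nonpos hmE (by linarith)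
      linarith [mul_nonneg hmC.le hℓ0]
  have hcapE2 : cP1 → γ < 1 / 2 → 1 - ρe ≤ 2 * δ → mE * (1 - 2 * γ) ≤ mC * ℓ := by
    intro _ h hnear
    rw [hℓ_lo h]
    have hinc : (1 - ρe) * ε ≤ 2 * (r * a) := by
      have : 1 - ρe ≤ 2 * (r * a / ε) := by rw [hδ] at hnear; linarith
      have e : 2 * (r * a / ε) * ε = 2 * (r * a) := by field_simp
      calc (1 - ρe) * ε ≤ 2 * (r * a / ε) * ε := mul_le_mul_of_nonneg_right this hε0.le
        _ = 2 * (r * a) := e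
    have key := R_E2 x r c a ρe ε γ hγ hx0 hx1 hr0 hrx hcx ha0 ha1 hlc hρe hρe1 hd h.le hinc
    have hκle : (x - c) * (1 - ρe) / ((1 + x - c) * (ρe - x)) ≤ 2 * r * a := by
      rw [div_le_iff₀ (mul_pos (by linarith) (by linarith))]; linarith
    rw [hκ]
    have := mul_le_mul_of_nonneg_left hκle (mul_nonneg hmC.le (by linarith : (0:ℝ) ≤ 1 - 2 * γ))
    calc mC * ((x - c) * (1 - ρe) / ((1 + x - c) * (ρe - x))) * (1 - 2 * γ)
        = mC * (1 - 2 * γ) * ((x - c) * (1 - ρe) / ((1 + x - c) * (ρe - x))) := by ring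
      _ ≤ mC * (1 - 2 * γ) * (2 * r * a) := this
      _ = mC * (2 * r * a * (1 - 2 * γ)) := by ring
  have hb1 : -(mC * ℓ) ≤ mE * ((1 - γ) * (βG * c₁ - (if cP1 then min 1 (UP1 * βG) else 1)) + γ * (1 - min 1 (UM1 * βG))) := by
    by_cases hc : cP1
    swap
    · exact b1_lower_of_cap γ c₁ UP1 UM1 mE (mC * ℓ) βG cP1 hγ1 hβG hmE (mul_nonneg hmC.le hℓ0) hUM10 hUM1c (hcapE hc)
    rcases lt_or_ge γ (1 / 2) with h | h
    swap
    · refine b1_lower_of_cap γ c₁ UP1 UM1 mE (mC * ℓ) βG cP1 hγ1 hβG hmE (mul_nonneg hmC.le hℓ0) hUM10 hUM1c ?_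
      have : mE * (1 - 2 * γ) ≤ 0 := mul_nonpos_of_nonneg_of_nonpos hmE (by linarith)
      linarith [mul_nonneg hmC.le hℓ0]
    rcases le_or_gt (1 - ρe) (2 * δ) with hnear | hfar
    · exact b1_lower_of_cap γ c₁ UP1 UM1 mE (mC * ℓ) βG cP1 hγ1 hβG hmE (mul_nonneg hmC.le hℓ0) hUM10 hUM1c (hcapE2 hc h hnear)
    -- the `w`-route: `P1` compatible, `δ < (1 − ρe)/2`, `γ < 1/2`
    have hS1 := hcP1.1 hc
    have hUP1v := hUP1 hS1
    have hUP10 : 0 < UP1 := by rw [hUP1v]; exact div_pos (by linarith) (by linarith)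
    have hUP1c : c₁ ≤ UP1 := by rw [hUP1v, hc₁]; exact UH_mono ρS ρe hS1 hρSe
    refine b1_lower γ c₁ UP1 UM1 mE (mC * ℓ) βG cP1 hγ0 hγ1 hβG hmE (mul_nonneg hmC.le hℓ0) hUM10 hUM1c
      (fun hc' => ⟨by rw [hUP1 (hcP1.1 hc')]; exact div_pos (by linarith) (by linarith), hUM1P hc'⟩)
      (fun hnc => absurd hc hnc) (fun _ => ?_)
    -- whenever `w ≥ 0` the left side is nonpositive
    have easy : (1 - γ) * (UP1 - c₁) ≤ γ * (UP1 - UM1) →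
        mE * ((1 - γ) * (UP1 - c₁) - γ * (UP1 - UM1)) ≤ mC * ℓ * UP1 := by
      intro hw
      have : mE * ((1 - γ) * (UP1 - c₁) - γ * (UP1 - UM1)) ≤ 0 := mul_nonpos_of_nonneg_of_nonpos hmE (by linarith)
      linarith [mul_nonneg (mul_nonneg hmC.le hℓ0) hUP10.le]
    rcases le_or_gt ρN x with hNx | hNx
    · -- light `M1`: `w ≥ 0` (lemma `R_L`)
      apply easy
      rw [hUP1v, hUM1l hNx, hc₁]
      exact R_L x r c a ρe ε γ ρS ρN hγ hρS hρN hx0 hx1 hr0 hrx hcx ha0 ha1 hlc hρe hρe1 hd h.le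
        (by rw [hδ] at hfar; linarith) hNx
    · -- heavy `M1`: the coupling (lemma `R_F`)
      have hUM1v := hUM1h hNx.le
      have hsδ : δ < 1 - ρe := by rw [eS] at hS1; linarith
      have hηs : η < ρe := by have := hρN0; rw [eN] at this; linarith
      have eW : (1 - γ) * (UP1 - c₁) - γ * (UP1 - UM1)
          = ((1 - γ) * δ * ((1 - ρe) + η) - γ * (δ + η) * (1 - ρe)) / ((1 - ρe) * ((1 - ρe) - δ) * ((1 - ρe) + η)) := by
        rw [hUP1v, hUM1v, hc₁, eS, eN]
        have h1 : (1 : ℝ) - ρe - δ ≠ 0 := by linarith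
        have h2 : (1 : ℝ) - ρe + η ≠ 0 := by linarith
        have h3 : (1 : ℝ) - ρe ≠ 0 := by linarith
        have h4 : (1 : ℝ) - (ρe + δ) ≠ 0 := by linarith
        have h5 : (1 : ℝ) - (ρe - η) ≠ 0 := by linarith
        field_simp
        ring
      have hmain := R_F x r c a ρe ε γ δ η hγ hδ hη hx0 hx1 hr0 hrx hcx ha0 ha1 hlc hρe hρe1 hd h.le hsδ.le
      have hsd : 0 < 1 - ρe - δ := by linarith
      have hsη : 0 < 1 - ρe + η := by linarith
      have hpos1 : 0 < (1 + x - c) * (ρe - x) := mul_pos (by linarith) (by linarith)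
      have hQ : 0 < (1 + x - c) * (ρe - x) * ((1 - ρe) + η) := mul_pos hpos1 hsη
      have hfrac : ((x - c) * (1 - ρe) / ((1 + x - c) * (ρe - x)))
          * (((1 - γ) * δ * ((1 - ρe) + η) - γ * (δ + η) * (1 - ρe)) / ((1 - ρe) * ((1 - ρe) - δ) * ((1 - ρe) + η)))
          ≤ ℓ * ((ρe + δ) / (1 - (ρe + δ))) := by
        have e1 : ((x - c) * (1 - ρe) / ((1 + x - c) * (ρe - x)))
            * (((1 - γ) * δ * ((1 - ρe) + η) - γ * (δ + η) * (1 - ρe)) / ((1 - ρe) * ((1 - ρe) - δ) * ((1 - ρe) + η)))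
            = ((x - c) * ((1 - γ) * δ * ((1 - ρe) + η) - γ * (δ + η) * (1 - ρe))
                / ((1 + x - c) * (ρe - x) * ((1 - ρe) + η))) / ((1 - ρe) - δ) := by
          have h2 : (1 : ℝ) + x - c ≠ 0 := by linarith
          have h3 : ρe - x ≠ 0 := by linarith
          have h4 : (1 : ℝ) - ρe ≠ 0 := by linarith
          have h5 : (1 : ℝ) - ρe - δ ≠ 0 := by linarith
          have h6 : (1 : ℝ) - ρe + η ≠ 0 := by linarith
          field_simp
        have e2 : ℓ * ((ρe + δ) / (1 - (ρe + δ))) = (ℓ * (ρe + δ)) / ((1 - ρe) - δ) := by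
          rw [show (1 : ℝ) - (ρe + δ) = (1 - ρe) - δ by ring]
          try ring
        rw [e1, e2]
        refine div_le_div_of_nonneg_right ((div_le_iff₀ hQ).2 ?_) hsd.le
        rw [hℓ_lo h]; linarith [hmain]
      calc mE * ((1 - γ) * (UP1 - c₁) - γ * (UP1 - UM1))
          = mC * (((x - c) * (1 - ρe) / ((1 + x - c) * (ρe - x)))
              * (((1 - γ) * δ * ((1 - ρe) + η) - γ * (δ + η) * (1 - ρe))
                / ((1 - ρe) * ((1 - ρe) - δ) * ((1 - ρe) + η)))) := by rw [hκ, eW]; ring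
        _ ≤ mC * (ℓ * ((ρe + δ) / (1 - (ρe + δ)))) := mul_le_mul_of_nonneg_left hfrac hmC.le
        _ = mC * ℓ * UP1 := by rw [hUP1v, eS]; ring
  -- ### assembly with the balance identity
  have hbal' : (1 - x) / x * (mE * c₁ + mC * c₂) = mE + mC := by
    have hx0' : x ≠ 0 := hx0.ne'
    have h1 : (1 : ℝ) - x ≠ 0 := h1x.ne'
    field_simp at hbal
    field_simp
    linarith [hbal]
  have hb2' := mul_le_mul_of_nonneg_left hb2 hmC.le
  have eR : (1 - x) / x * (γ * (mE * c₁ + mC * c₂)) = γ * (mE + mC) := by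
    rw [← hbal']; ring
  rw [eR]
  linarith [hb2', hb1]


end TwoMidCell

end LawDec

end Quant

end Summit.CriticalPhenomena.PercolationContinuityZ3.Theorems
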